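import Summits.ResolutionOfSingularities.ResolutionOfSingularities.Theorems.FrobeniusLadderFInjectiveMacaulayficationSigma5P2d5CNewtonKCoverRecords
import Summits.ResolutionOfSingularities.ResolutionOfSingularities.Theorems.FrobeniusLadderFInjectiveMacaulayficationSigma5P2d5CNewtonKFanChecks
import Summits.ResolutionOfSingularities.ResolutionOfSingularities.Theorems.FrobeniusLadderFInjectiveMacaulayficationFanCheckChunks
import Mathlib.Tactic.IntervalCases
import HarnessLib

/-!
# KERNEL CHECKS (cover records) of the class-route cover data for P2d5C shifted, f′ = σ₅(f_P2d5C) = z² + x⁴z + x⁹ + x¹⁰ + y³ + u³ + t³ + s³ (f_P2d5C = z² + x⁴z + y³ + u³ + t³ + s³ = the (5,2) census bed of row (5,2) #1, σ₅ : z ↦ z + x⁵, char 2; six variables (x,y,u,t,s,z) = X0..X5): the sparse multi-vertex cover records, ONE `decide +kernel` per block `j` of the product table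
# (crux `FInjectiveMacaulayfication` stmt-ResolutionOfSingularities-15315, chain w45a; (W-WND) class-route coverage programme, res-L1-w45a-plan-1 RULING R22.14 (2); seat res-L1-w45a-stub-2 g11)

Support file for crux stmt-ResolutionOfSingularities-15315 (`FrobeniusLadder.FInjectiveMacaulayfication`), chain w45a.
[OURS · L1 W4.5a] — NOT a statement of any manuscript; AI-written, weaker than expert review.

`FanCheckChunks.checkHcovMultiL 6 (blockGens KL2 j) MV2 50 71 (RLMB j)` for `j < 6` (block `j` = the 245 generators `b + e_j`, records `RLM2_j` of `Sigma5P2d5CNewtonKCoverRecords`,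
certificate `P2d5Cs5_cover.json` bb735479b82e1976; `Σ cnt ≤ 4830`), and the `∀ j < 6` form consumed by `FanCheckChunks.hcov_of_blocks`. No definitions, no named facts. [folklore]
-/

-- single-problem summit: the doubled namespace component is forced
set_option linter.dupNamespace false

namespace Summit.ResolutionOfSingularities.ResolutionOfSingularities.Theorems.FInjectiveMacaulayfication.Sigma5P2d5CNewtonKFan

open Summit.ResolutionOfSingularities.ResolutionOfSingularities.Theorems.FInjectiveMacaulayfication
open FanCheckKit FanCheckSound FanCheckChunks

/-- Cover records, block 0 (`b + e_0`), with the specimen-distinct conjunct `CL.length = 71`. -/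
theorem check_hcov_0 : checkHcovMultiL 6 (blockGens KL2 0) MV2 50 71 (RLMB 0) = true ∧ CL.length = 71 := ⟨by decide +kernel, tlen⟩

/-- Cover records, block 1 (`b + e_1`), with the specimen-distinct conjunct `CL.length = 71`. -/
theorem check_hcov_1 : checkHcovMultiL 6 (blockGens KL2 1) MV2 50 71 (RLMB 1) = true ∧ CL.length = 71 := ⟨by decide +kernel, tlen⟩

/-- Cover records, block 2 (`b + e_2`), with the specimen-distinct conjunct `CL.length = 71`. -/
theorem check_hcov_2 : checkHcovMultiL 6 (blockGens KL2 2) MV2 50 71 (RLMB 2) = true ∧ CL.length = 71 := ⟨by decide +kernel, tlen⟩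

/-- Cover records, block 3 (`b + e_3`), with the specimen-distinct conjunct `CL.length = 71`. -/
theorem check_hcov_3 : checkHcovMultiL 6 (blockGens KL2 3) MV2 50 71 (RLMB 3) = true ∧ CL.length = 71 := ⟨by decide +kernel, tlen⟩

/-- Cover records, block 4 (`b + e_4`), with the specimen-distinct conjunct `CL.length = 71`. -/
theorem check_hcov_4 : checkHcovMultiL 6 (blockGens KL2 4) MV2 50 71 (RLMB 4) = true ∧ CL.length = 71 := ⟨by decide +kernel, tlen⟩

/-- Cover records, block 5 (`b + e_5`), with the specimen-distinct conjunct `CL.length = 71`. -/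
theorem check_hcov_5 : checkHcovMultiL 6 (blockGens KL2 5) MV2 50 71 (RLMB 5) = true ∧ CL.length = 71 := ⟨by decide +kernel, tlen⟩

/-- ★ All block checks, in the `∀ j < 6` shape of `FanCheckChunks.hcov_of_blocks` (with the specimen-distinct conjunct). -/
theorem check_hcov : (∀ j < 6, checkHcovMultiL 6 (blockGens KL2 j) MV2 50 71 (RLMB j) = true) ∧ CL.length = 71 := by
  refine ⟨fun j hj => ?_, tlen⟩
  interval_cases j
  · exact check_hcov_0.1
  · exact check_hcov_1.1
  · exact check_hcov_2.1
  · exact check_hcov_3.1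
  · exact check_hcov_4.1
  · exact check_hcov_5.1


end Summit.ResolutionOfSingularities.ResolutionOfSingularities.Theorems.FInjectiveMacaulayfication.Sigma5P2d5CNewtonKFan
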